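import Literature.Analysis.Approximation.MarkovCoefficientInequality
import HarnessLib

/-!
# V. A. Markov's coefficient inequality — the node-wise hypothesis `p ∈ C_n` (Rivlin's form)

T. J. Rivlin, *The Chebyshev Polynomials* (Wiley, 1974) [Rivlin1974], Sect. 2.7 Remark 2, (2.44)–(2.45), AS PRINTED:
the hypothesis is not `|p| ≤ 1` on `I = [-1, 1]` but only `p ∈ C_n`, i.e. `|p(η_j^{(n)})| ≤ 1` at the `n + 1` extrema
`η_j^{(n)} = cos(jπ/n)` of `T_n` (Rivlin Sect. 2.7, p. 93: `B_n ⊂ C_n`).  The interpolation proof of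
`MarkovCoefficientInequality.lean` uses the values of `p` at these nodes only, so it gives the printed form verbatim:

* `sumNodes_le_sumNodes_T_of_node` — Mathlib's comparison `Polynomial.Chebyshev.sumNodes_le_sumNodes_T` under the
  node-wise hypothesis;
* `abs_coeff_le_abs_coeff_T_of_node`, `abs_coeff_le_of_abs_eval_node_le` — **(2.44)**: `deg p ≤ n`,
  `|p(η_j^{(n)})| ≤ M` (`j = 0, …, n`), `s + 2t = n` ⟹ `|a_s(p)| ≤ M |t_s^{(n)}|`;
* `abs_coeff_le_of_abs_eval_node_le_succ` — **(2.45)** (with `n + 1` in place of Rivlin's `n`): `deg p ≤ n + 1`,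
  `n ≥ 1`, `|p(η_j^{(n)})| ≤ M` (`j = 0, …, n`), `s + 2t = n` ⟹ `|a_s(p)| ≤ M |t_s^{(n)}|` — the parity-`s` part of
  `p` is again in `M · C_n` because the node set is symmetric (`η_{n-j} = -η_j`).  (`n ≥ 1` is needed: for `n = 0`
  the "extrema of `T_0`" degenerate to the single point `1` and `p = 3x - 2` violates the conclusion.)

NOT here: the equality cases `p = ± T_n` / `± T_{n-1}` of Remark 2.
-/

noncomputable section

namespace Literature.Analysis.Approximation.MarkovCoefficientInequality

open Polynomial Polynomial.Chebyshev Real Finset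

/-- Mathlib's node comparison under the NODE-WISE hypothesis: if `(-1)^i c_i ≥ 0` and `|P(η_i)| ≤ 1` for
`i = 0, …, n`, then `Σ_i P(η_i) c_i ≤ Σ_i T_n(η_i) c_i`. [cite: Rivlin1974, Sect. 2.7 Remark 2 (2.44)] -/
theorem sumNodes_le_sumNodes_T_of_node {n : ℕ} {c : ℕ → ℝ} (hc : ∀ i ≤ n, 0 ≤ (-1) ^ i * c i) {P : ℝ[X]}
    (hb : ∀ i ≤ n, |P.eval (node n i)| ≤ 1) : sumNodes n c P ≤ sumNodes n c (T ℝ n) := by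
  rw [sumNodes, sumNodes]
  refine Finset.sum_le_sum fun i hi => ?_
  have hi' : i ≤ n := Finset.mem_Iic.mp hi
  have h2 := hc i hi'
  have h3 : (-1 : ℝ) ^ i * P.eval (node n i) ≤ 1 := by
    have h : |(-1 : ℝ) ^ i * P.eval (node n i)| ≤ 1 := by
      rw [abs_mul, abs_neg_one_pow, one_mul]; exact hb i hi'
    exact (abs_le.1 h).2
  have e : P.eval (node n i) * c i = ((-1) ^ i * P.eval (node n i)) * ((-1) ^ i * c i) := by
    calc P.eval (node n i) * c i = ((-1 : ℝ) ^ i * (-1) ^ i) * (P.eval (node n i) * c i) := by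
          rw [← mul_pow]; norm_num
      _ = _ := by ring
  rw [eval_T_real_node hi, e]
  nlinarith

/-- **(2.44) as printed, bound `1`.**  `deg p ≤ n`, `|p(η_j^{(n)})| ≤ 1` for `j ≤ n`, `s + 2t = n` ⟹
`|a_s(p)| ≤ |t_s^{(n)}|`. [cite: Rivlin1974, Sect. 2.7 Remark 2 (2.44)] -/
theorem abs_coeff_le_abs_coeff_T_of_node {n : ℕ} {P : ℝ[X]} (hP : P.degree ≤ n)
    (hb : ∀ j ≤ n, |P.eval (node n j)| ≤ 1) {s t : ℕ} (hst : s + 2 * t = n) :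
    |P.coeff s| ≤ |(T ℝ n).coeff s| := by
  set c : ℕ → ℝ := fun i => (-1) ^ t * (Lagrange.basis (range (n + 1)) (node n) i).coeff s with hc
  have hcs : ∀ i ≤ n, 0 ≤ (-1) ^ i * c i := fun i hi => sign_coeff_basis hi hst
  have key : ∀ Q : ℝ[X], Q.degree ≤ n → sumNodes n c Q = (-1) ^ t * Q.coeff s := by
    intro Q hQ
    rw [sumNodes, coeff_eq_sum_node hQ s, mul_sum, ← Nat.range_succ_eq_Iic]
    exact sum_congr rfl fun i _ => by rw [hc]; ring
  have hT : (T ℝ n).degree ≤ n := by rw [degree_T, Int.natAbs_natCast]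
  have h1 := sumNodes_le_sumNodes_T_of_node hcs hb
  have h2 := sumNodes_le_sumNodes_T_of_node hcs (P := -P) (fun j hj => by simpa using hb j hj)
  rw [key P hP, key _ hT] at h1
  rw [key (-P) (by rwa [degree_neg]), key _ hT, coeff_neg] at h2
  have habs : |(-1 : ℝ) ^ t * P.coeff s| ≤ (-1) ^ t * (T ℝ n).coeff s := abs_le.2 ⟨by linarith, h1⟩
  calc |P.coeff s| = |(-1 : ℝ) ^ t * P.coeff s| := by rw [abs_mul, abs_neg_one_pow, one_mul]
    _ ≤ (-1) ^ t * (T ℝ n).coeff s := habs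
    _ ≤ |(-1 : ℝ) ^ t * (T ℝ n).coeff s| := le_abs_self _
    _ = |(T ℝ n).coeff s| := by rw [abs_mul, abs_neg_one_pow, one_mul]

/-- **(2.44) as printed, bound `M`** (`p ∈ M · C_n`).  `deg p ≤ n`, `|p(η_j^{(n)})| ≤ M` for `j ≤ n`,
`s + 2t = n` ⟹ `|a_s(p)| ≤ M |t_s^{(n)}|`. [cite: Rivlin1974, Sect. 2.7 Remark 2 (2.44)] -/
theorem abs_coeff_le_of_abs_eval_node_le {n : ℕ} {P : ℝ[X]} (hP : P.degree ≤ n) {M : ℝ}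
    (hb : ∀ j ≤ n, |P.eval (node n j)| ≤ M) {s t : ℕ} (hst : s + 2 * t = n) :
    |P.coeff s| ≤ M * |(T ℝ n).coeff s| := by
  have hM : 0 ≤ M := (abs_nonneg _).trans (hb 0 (Nat.zero_le n))
  rcases hM.eq_or_lt with hM0 | hMpos
  · -- `M = 0`: `P` vanishes at `n + 1` distinct nodes, so `P = 0`
    have hlt : P.degree < #(range (n + 1)) := by
      rw [card_range]
      exact lt_of_le_of_lt hP (by exact_mod_cast Nat.lt_succ_self n)
    have hP0 : P = 0 := by
      rw [Lagrange.eq_interpolate (strictAntiOn_node n).injOn hlt, Lagrange.interpolate_apply]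
      refine sum_eq_zero fun i hi => ?_
      have h := hb i (Nat.lt_succ_iff.mp (mem_range.mp hi))
      rw [← hM0] at h
      rw [abs_nonpos_iff.1 h, map_zero, zero_mul]
    rw [hP0, ← hM0]; simp
  · have hb' : ∀ j ≤ n, |(C M⁻¹ * P).eval (node n j)| ≤ 1 := by
      intro j hj
      rw [eval_mul, eval_C, abs_mul, abs_inv, abs_of_pos hMpos, inv_mul_le_iff₀ hMpos, mul_one]
      exact hb j hj
    have hdeg : (C M⁻¹ * P).degree ≤ n := (degree_C_mul (inv_ne_zero hMpos.ne')).le.trans hP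
    have h := abs_coeff_le_abs_coeff_T_of_node hdeg hb' hst
    rwa [coeff_C_mul, abs_mul, abs_inv, abs_of_pos hMpos, inv_mul_le_iff₀ hMpos] at h

/-- Private copy of the folklore parity rule `[x^k] p(-x) = (-1)^k [x^k] p(x)`. [folklore] -/
private theorem coeff_comp_negX' (p : ℝ[X]) (k : ℕ) :
    (p.comp (-X)).coeff k = (-1) ^ k * p.coeff k := by
  induction p using Polynomial.induction_on' with
  | add p q hp hq => simp only [add_comp, coeff_add, hp, hq, mul_add]
  | monomial m a =>
      rw [← C_mul_X_pow_eq_monomial, mul_comp, C_comp, X_pow_comp, neg_pow,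
        show (-1 : ℝ[X]) ^ m = Polynomial.C ((-1 : ℝ) ^ m) by simp, ← mul_assoc, ← map_mul,
        coeff_C_mul_X_pow, coeff_C_mul_X_pow]
      split_ifs with h
      · subst h; ring
      · simp

/-- **(2.45) as printed** (indices shifted: Rivlin's `n` is `n + 1` here), together with (2.44): for `n ≥ 1`,
`deg p ≤ n + 1`, `|p(η_j^{(n)})| ≤ M` at the `n + 1` extrema of `T_n`, and `s + 2t = n`:
`|a_s(p)| ≤ M |t_s^{(n)}|`.  The parity-`s` part `q = (p(x) + (-1)^n p(-x))/2` has degree `≤ n`, the same `s`-th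
coefficient, and `|q(η_j)| ≤ (|p(η_j)| + |p(η_{n-j})|)/2 ≤ M` since `-η_j = η_{n-j}`.
[cite: Rivlin1974, Sect. 2.7 Remark 2 (2.44)-(2.45)] -/
theorem abs_coeff_le_of_abs_eval_node_le_succ {n : ℕ} (hn : n ≠ 0) {P : ℝ[X]} (hP : P.natDegree ≤ n + 1)
    {M : ℝ} (hb : ∀ j ≤ n, |P.eval (node n j)| ≤ M) {s t : ℕ} (hst : s + 2 * t = n) :
    |P.coeff s| ≤ M * |(T ℝ n).coeff s| := by
  set Q : ℝ[X] := C (1 / 2 : ℝ) * (P + C ((-1 : ℝ) ^ n) * P.comp (-X)) with hQ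
  have hQc : ∀ k, Q.coeff k = 1 / 2 * (P.coeff k + (-1) ^ n * ((-1) ^ k * P.coeff k)) := by
    intro k; rw [hQ, coeff_C_mul, coeff_add, coeff_C_mul, coeff_comp_negX']
  have hQs : Q.coeff s = P.coeff s := by
    rw [hQc, ← mul_assoc, ← pow_add, show n + s = 2 * (s + t) by omega, pow_mul]
    norm_num; ring
  have hQdeg : Q.natDegree ≤ n := by
    rw [natDegree_le_iff_coeff_eq_zero]
    intro N hN
    rw [hQc]
    rcases eq_or_lt_of_le (Nat.succ_le_of_lt hN) with h | h
    · rw [← h]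
      have e : (-1 : ℝ) ^ n * (-1) ^ (n + 1) = -1 := by
        rw [← pow_add, show n + (n + 1) = 2 * n + 1 by ring, pow_succ, pow_mul]; norm_num
      calc (1 : ℝ) / 2 * (P.coeff (n + 1) + (-1) ^ n * ((-1) ^ (n + 1) * P.coeff (n + 1)))
          = 1 / 2 * (P.coeff (n + 1) + ((-1) ^ n * (-1) ^ (n + 1)) * P.coeff (n + 1)) := by ring
        _ = 0 := by rw [e]; ring
    · rw [coeff_eq_zero_of_natDegree_lt (by omega)]; ring
  have hQb : ∀ j ≤ n, |Q.eval (node n j)| ≤ M := by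
    intro j hj
    have h1 := hb j hj
    have h2 := hb (n - j) (Nat.sub_le n j)
    rw [node_sub hn hj] at h2
    have h3 : |P.eval (node n j) + (-1) ^ n * P.eval (-node n j)| ≤
        |P.eval (node n j)| + |P.eval (-node n j)| := by
      calc |P.eval (node n j) + (-1) ^ n * P.eval (-node n j)|
          ≤ |P.eval (node n j)| + |(-1 : ℝ) ^ n * P.eval (-node n j)| := abs_add_le _ _
        _ = |P.eval (node n j)| + |P.eval (-node n j)| := by rw [abs_mul, abs_neg_one_pow, one_mul]
    rw [hQ]
    simp only [eval_mul, eval_C, eval_add, eval_comp, eval_neg, eval_X]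
    rw [abs_mul, abs_of_pos (by norm_num : (0 : ℝ) < 1 / 2)]
    linarith
  rw [← hQs]
  exact abs_coeff_le_of_abs_eval_node_le (degree_le_of_natDegree_le hQdeg) hQb hst

end Literature.Analysis.Approximation.MarkovCoefficientInequality

end
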